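import Summits.KontsevichZagierPeriods.KontsevichZagierPeriods.Theses.FurushoPentagon
import Literature.NumberTheory.Transcendental.KZCubicalCalculus
import Literature.RingTheory.MvPowerSeries.ConvergentPowerSeries

/-!
# `SectorToKernel`, line `effective-cube-surjection`: formal ⟺ functional relations (stub S3a)

Stub `stub_formalIffFunctional` of the crux `FurushoPentagon.SectorToKernel`
(stmt-KontsevichZagierPeriods-10813). For a real power series `F` in `M` variables with summable
majorant `∑ₐ |Fₐ| ρ^{|a|} < ∞` of polyradius `ρ > 1`, summing to `g` on the closed unit cube
`[0,1]ᴹ`, and a polynomial `P ∈ ℚ[x][Y]`: `P(F) = 0` formally in `ℝ⟦x⟧` iff `P(x, g x) = 0` for all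
`x ∈ [0,1]ᴹ`.

Everything is done at the constant polyradius `1` in the vocabulary of
`Literature/RingTheory/MvPowerSeries/ConvergentPowerSeries.lean` (`wnorm`, `eval`): the hypothesis
gives `‖F‖₁ = ∑ₐ |Fₐ| < ∞`, so `g = eval F` on the cube (`hasSum_eval`), and evaluation is a ring
homomorphism on the pseudo-Banach algebra `‖·‖₁ < ∞` (`eval_mul`, `eval_pow`, `eval_finset_sum`),
which on polynomials is polynomial evaluation; this gives `eval (P(F)) x = P(x, g x)` on the cube
and the implication `⇒`. For `⇐` we prove the **identity theorem on the cube**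
(`fif_eq_zero_of_eval_eq_zero`): a power series `Q` with `‖Q‖₁ < ∞` whose sum vanishes on `[0,1]ᴹ`
is `0`. Induction on `M`, splitting off the first variable: `eval Q (t, x) = ∑ₙ (eval Qₙ x) tⁿ`
with `Qₙ` the slice of coefficients of `x₀ⁿ` (regrouping of the absolutely convergent double
series, `HasSum.prod_fiberwise`), and the elementary one-variable fact that an absolutely summable
power series `∑ bₙ tⁿ` vanishing on `[0,1]` has all `bₙ = 0` (`b₀ = value at 0`, divide by `t`,
pass to the limit `t → 0⁺` by uniform convergence, iterate).

References: H. Grauert, R. Remmert, *Analytische Stellenalgebren* (1971), Kap. I §§1–3;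
S. G. Krantz, H. R. Parks, *A Primer of Real Analytic Functions* (2002), §2.2; folklore.
-/

noncomputable section

namespace Summit.KontsevichZagierPeriods.FurushoPentagon.SectorToKernel

section Helpers

open Set
open MvPowerSeries (coeff constantCoeff)
open Literature.RingTheory.MvPowerSeries
open Literature.NumberTheory.Transcendental
open scoped NNReal ENNReal Topology

/-! ## One variable: an absolutely summable power series vanishing on `[0,1]` is zero -/

/-- If `∑ₙ |bₙ| < ∞` and `∑ₙ bₙ tⁿ = 0` on `[0,1]`, then `b₀ = 0` and the shifted series
`∑ₙ bₙ₊₁ tⁿ` has the same two properties (it is continuous on `[0,1]` and vanishes on `(0,1]`).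
[folklore] -/
theorem fif_coeff_zero_and_shift (b : ℕ → ℝ) (hb : Summable fun n => ‖b n‖)
    (h0 : ∀ t ∈ Icc (0 : ℝ) 1, ∑' n, b n * t ^ n = 0) :
    b 0 = 0 ∧ (Summable fun n => ‖b (n + 1)‖) ∧
      ∀ t ∈ Icc (0 : ℝ) 1, ∑' n, b (n + 1) * t ^ n = 0 := by
  have hb0 : b 0 = 0 := by
    have h := h0 0 ⟨le_rfl, zero_le_one⟩
    rw [tsum_eq_single 0, pow_zero, mul_one] at h
    · exact h
    · intro n hn
      simp [hn]
  have hb' : Summable fun n => ‖b (n + 1)‖ := (summable_nat_add_iff (f := fun n => ‖b n‖) 1).2 hb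
  have hbound : ∀ (c t : ℝ) (n : ℕ), t ∈ Icc (0 : ℝ) 1 → ‖c * t ^ n‖ ≤ ‖c‖ := by
    intro c t n ht
    rw [norm_mul, norm_pow]
    refine mul_le_of_le_one_right (norm_nonneg _) (pow_le_one₀ (norm_nonneg _) ?_)
    rw [Real.norm_eq_abs, abs_le]
    exact ⟨by linarith [ht.1], ht.2⟩
  refine ⟨hb0, hb', ?_⟩
  have hcont : ContinuousOn (fun t : ℝ => ∑' n, b (n + 1) * t ^ n) (Icc 0 1) :=
    continuousOn_tsum (fun n => (continuous_const.mul (continuous_pow n)).continuousOn) hb'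
      fun n t ht => hbound _ _ _ ht
  have hIoc : EqOn (fun t : ℝ => ∑' n, b (n + 1) * t ^ n) (fun _ => 0) (Ioc 0 1) := by
    intro t ht
    have hsum : Summable fun n => b n * t ^ n :=
      hb.of_norm_bounded fun n => hbound _ _ _ ⟨ht.1.le, ht.2⟩
    have h := h0 t ⟨ht.1.le, ht.2⟩
    rw [hsum.tsum_eq_zero_add, hb0, zero_mul, zero_add] at h
    have h' : t * ∑' n, b (n + 1) * t ^ n = 0 := by
      calc t * ∑' n, b (n + 1) * t ^ n = ∑' n, b (n + 1) * t ^ (n + 1) := by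
            rw [← tsum_mul_left]; exact tsum_congr fun n => by ring
        _ = 0 := h
    exact (mul_eq_zero.1 h').resolve_left ht.1.ne'
  have hIcc := hIoc.of_subset_closure hcont continuousOn_const Ioc_subset_Icc_self
    (by rw [closure_Ioc zero_ne_one])
  exact fun t ht => hIcc ht

/-- **One-variable identity principle on `[0,1]`**: if `∑ₙ |bₙ| < ∞` and `∑ₙ bₙ tⁿ = 0` for all
`t ∈ [0,1]`, then every `bₙ = 0`. [Krantz–Parks 2002, §1.1–1.2; folklore] -/
theorem fif_coeff_eq_zero (n : ℕ) : ∀ (b : ℕ → ℝ), (Summable fun k => ‖b k‖) →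
    (∀ t ∈ Icc (0 : ℝ) 1, ∑' k, b k * t ^ k = 0) → b n = 0 := by
  induction n with
  | zero => exact fun b hb h0 => (fif_coeff_zero_and_shift b hb h0).1
  | succ n ih =>
    intro b hb h0
    have H := fif_coeff_zero_and_shift b hb h0
    exact ih (fun k => b (k + 1)) H.2.1 H.2.2

/-! ## Polyradius `1`: norms, cube points, polynomials -/

/-- At the constant polyradius `1` every monomial has weight `1`. [folklore] -/
theorem fif_wt_one {σ : Type*} (α : σ →₀ ℕ) : wt (fun _ : σ => (1 : ℝ≥0)) α = 1 := by
  rw [wt_eq_prod]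
  exact Finset.prod_eq_one fun i _ => one_pow _

/-- `‖f‖₁ = ∑ₐ ‖fₐ‖`. [folklore] -/
theorem fif_wnorm_one {σ : Type*} (f : MvPowerSeries σ ℝ) :
    wnorm (fun _ : σ => (1 : ℝ≥0)) f = ∑' α, (‖coeff α f‖₊ : ℝ≥0∞) := by
  unfold wnorm
  exact tsum_congr fun α => by rw [fif_wt_one, mul_one]

/-- A summable majorant of polyradius `ρ ≥ 1` gives `‖F‖₁ < ∞`. [folklore] -/
theorem fif_wnorm_lt_top {M : ℕ} {F : MvPowerSeries (Fin M) ℝ} {ρ : ℝ} (hρ : 1 ≤ ρ)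
    (hF : Summable fun a : Fin M →₀ ℕ => |coeff a F| * ρ ^ (a.sum fun _ e => e)) :
    wnorm (fun _ : Fin M => (1 : ℝ≥0)) F < ⊤ := by
  have h1 : Summable fun a : Fin M →₀ ℕ => ((‖coeff a F‖₊ : ℝ≥0) : ℝ) := by
    refine Summable.of_nonneg_of_le (fun a => NNReal.coe_nonneg _) (fun a => ?_) hF
    rw [coe_nnnorm, Real.norm_eq_abs]
    exact le_mul_of_one_le_right (abs_nonneg _) (one_le_pow₀ hρ)
  rw [fif_wnorm_one, lt_top_iff_ne_top, ENNReal.tsum_coe_ne_top_iff_summable]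
  exact NNReal.summable_coe.1 h1

/-- Points of the closed unit cube lie in the closed unit polydisc. [folklore] -/
theorem fif_nnnorm_le_of_mem_cube {M : ℕ} {x : Fin M → ℝ} (hx : x ∈ KZ.cube M) :
    ∀ i, ‖x i‖₊ ≤ (1 : ℝ≥0) := by
  intro i
  have h := KZ.mem_cube.1 hx i
  rw [← NNReal.coe_le_coe, coe_nnnorm, NNReal.coe_one, Real.norm_eq_abs, abs_le]
  exact ⟨by linarith [h.1], h.2⟩

/-- `[0,1] ⊆ closed unit disc`. [folklore] -/
theorem fif_nnnorm_le_of_mem_Icc {t : ℝ} (ht : t ∈ Icc (0 : ℝ) 1) : ‖t‖₊ ≤ (1 : ℝ≥0) := by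
  rw [← NNReal.coe_le_coe, coe_nnnorm, NNReal.coe_one, Real.norm_eq_abs, abs_le]
  exact ⟨by linarith [ht.1], ht.2⟩

/-- Prepending a coordinate in `[0,1]` to a point of `[0,1]ᴹ` gives a point of `[0,1]ᴹ⁺¹`.
[folklore] -/
theorem fif_cons_mem_cube {M : ℕ} {t : ℝ} (ht : t ∈ Icc (0 : ℝ) 1) {x : Fin M → ℝ}
    (hx : x ∈ KZ.cube M) : (Fin.cons t x : Fin (M + 1) → ℝ) ∈ KZ.cube (M + 1) :=
  KZ.mem_cube.2 (Fin.cases (by simpa using ht) fun j => by simpa using KZ.mem_cube.1 hx j)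

/-- A polynomial has finite weighted norm at every polyradius. [folklore] -/
theorem fif_wnorm_coe_lt_top {σ : Type*} (ρ : σ → ℝ≥0) (q : MvPolynomial σ ℝ) :
    wnorm ρ (q : MvPowerSeries σ ℝ) < ⊤ := by
  induction q using MvPolynomial.induction_on with
  | C a => rw [MvPolynomial.coe_C, wnorm_C]; exact ENNReal.coe_lt_top
  | add p q hp hq =>
    rw [MvPolynomial.coe_add]
    exact (wnorm_add_le ρ _ _).trans_lt (ENNReal.add_lt_top.2 ⟨hp, hq⟩)
  | mul_X p i hp =>
    rw [MvPolynomial.coe_mul, MvPolynomial.coe_X]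
    refine (wnorm_mul_le ρ _ _).trans_lt (ENNReal.mul_lt_top hp ?_)
    rw [wnorm_X]
    exact ENNReal.coe_lt_top

/-- On polynomials, evaluation of power series is polynomial evaluation (a finite sum, valid at
every point). [folklore] -/
theorem fif_eval_coe {σ : Type*} (q : MvPolynomial σ ℝ) (x : σ → ℝ) :
    eval (q : MvPowerSeries σ ℝ) x = MvPolynomial.eval x q := by
  classical
  unfold eval
  rw [MvPolynomial.eval_eq, tsum_eq_sum (s := q.support)]
  · exact Finset.sum_congr rfl fun α _ => by rw [MvPolynomial.coeff_coe]; rfl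
  · intro α hα
    rw [MvPolynomial.coeff_coe, MvPolynomial.notMem_support_iff.1 hα, zero_mul]

/-! ## Splitting off the first variable -/

/-- The index bijection `(n, β) ↦ cons n β : ℕ × (Fin M →₀ ℕ) ≃ (Fin (M+1) →₀ ℕ)`. [folklore] -/
theorem fif_exists_consEquiv (M : ℕ) :
    ∃ e : ℕ × (Fin M →₀ ℕ) ≃ (Fin (M + 1) →₀ ℕ), ∀ p, e p = Finsupp.cons p.1 p.2 :=
  ⟨{ toFun := fun p => Finsupp.cons p.1 p.2
     invFun := fun α => (α 0, Finsupp.tail α)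
     left_inv := fun p => Prod.ext (Finsupp.cons_zero p.1 p.2) (Finsupp.tail_cons p.1 p.2)
     right_inv := fun α => Finsupp.cons_tail α }, fun _ => rfl⟩

/-- Monomials split: `(t, x)^(cons n β) = tⁿ · x^β`. [folklore] -/
theorem fif_mono_cons {M : ℕ} (t : ℝ) (x : Fin M → ℝ) (n : ℕ) (β : Fin M →₀ ℕ) :
    mono (Fin.cons t x : Fin (M + 1) → ℝ) (Finsupp.cons n β) = t ^ n * mono x β := by
  simp only [mono, Finsupp.prod_pow, Fin.prod_univ_succ, Finsupp.cons_zero, Finsupp.cons_succ,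
    Fin.cons_zero, Fin.cons_succ]

/-- **Slices.** If `Sₙ` is the power series in the remaining variables formed by the coefficients
of `x₀ⁿ` in `Q`, then `∑ₙ ‖Sₙ‖₁ = ‖Q‖₁`. [folklore] -/
theorem fif_tsum_wnorm_slice {M : ℕ} (Q : MvPowerSeries (Fin (M + 1)) ℝ)
    (S : ℕ → MvPowerSeries (Fin M) ℝ) (hS : ∀ n β, coeff β (S n) = coeff (Finsupp.cons n β) Q) :
    ∑' n, wnorm (fun _ : Fin M => (1 : ℝ≥0)) (S n) =
      wnorm (fun _ : Fin (M + 1) => (1 : ℝ≥0)) Q := by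
  obtain ⟨e, he⟩ := fif_exists_consEquiv M
  calc ∑' n, wnorm (fun _ : Fin M => (1 : ℝ≥0)) (S n)
      = ∑' (n : ℕ) (β : Fin M →₀ ℕ), (‖coeff (Finsupp.cons n β) Q‖₊ : ℝ≥0∞) := by
        simp only [fif_wnorm_one, hS]
    _ = ∑' p : ℕ × (Fin M →₀ ℕ), (‖coeff (e p) Q‖₊ : ℝ≥0∞) := by
        rw [ENNReal.tsum_prod']
        simp only [he]
    _ = wnorm (fun _ : Fin (M + 1) => (1 : ℝ≥0)) Q := by
        rw [fif_wnorm_one]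
        exact e.tsum_eq (fun α => (‖coeff α Q‖₊ : ℝ≥0∞))

/-- Each slice has norm at most `‖Q‖₁`. [folklore] -/
theorem fif_wnorm_slice_le {M : ℕ} (Q : MvPowerSeries (Fin (M + 1)) ℝ)
    (S : ℕ → MvPowerSeries (Fin M) ℝ) (hS : ∀ n β, coeff β (S n) = coeff (Finsupp.cons n β) Q)
    (n : ℕ) :
    wnorm (fun _ : Fin M => (1 : ℝ≥0)) (S n) ≤ wnorm (fun _ : Fin (M + 1) => (1 : ℝ≥0)) Q := by
  rw [← fif_tsum_wnorm_slice Q S hS]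
  exact ENNReal.le_tsum n

/-- **Splitting off the first variable**: for `‖Q‖₁ < ∞`, `|t| ≤ 1` and `x` in the closed unit
polydisc, `eval Q (t, x) = ∑ₙ (eval Sₙ x) tⁿ` (regrouping an absolutely convergent double series).
[Grauert–Remmert 1971, Kap. I §3; folklore] -/
theorem fif_hasSum_slice {M : ℕ} (Q : MvPowerSeries (Fin (M + 1)) ℝ)
    (S : ℕ → MvPowerSeries (Fin M) ℝ) (hS : ∀ n β, coeff β (S n) = coeff (Finsupp.cons n β) Q)
    (hQ : wnorm (fun _ : Fin (M + 1) => (1 : ℝ≥0)) Q < ⊤) {t : ℝ} (ht : ‖t‖₊ ≤ (1 : ℝ≥0))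
    {x : Fin M → ℝ} (hx : ∀ i, ‖x i‖₊ ≤ (1 : ℝ≥0)) :
    HasSum (fun n => eval (S n) x * t ^ n) (eval Q (Fin.cons t x)) := by
  obtain ⟨e, he⟩ := fif_exists_consEquiv M
  have hx' : ∀ i, ‖(Fin.cons t x : Fin (M + 1) → ℝ) i‖₊ ≤ (fun _ : Fin (M + 1) => (1 : ℝ≥0)) i :=
    Fin.cases (by simpa using ht) fun j => by simpa using hx j
  have h1 := e.hasSum_iff.2 (hasSum_eval hx' hQ)
  refine h1.prod_fiberwise fun n => ?_
  have h2 := (hasSum_eval (ρ := fun _ : Fin M => (1 : ℝ≥0)) hx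
    ((fif_wnorm_slice_le Q S hS n).trans_lt hQ)).mul_right (t ^ n)
  refine h2.congr_fun fun β => ?_
  simp only [Function.comp_apply, he, fif_mono_cons, hS]
  ring

/-! ## The identity theorem on the cube -/

/-- **Identity theorem on the closed unit cube.** A real power series `Q` in `M` variables with
`‖Q‖₁ = ∑ₐ |Qₐ| < ∞` whose sum vanishes at every point of `[0,1]ᴹ` is zero (induction on `M`,
splitting off the first variable and applying the one-variable principle `fif_coeff_eq_zero` to
`t ↦ ∑ₙ (eval Sₙ x) tⁿ`). [Krantz–Parks 2002, §2.2; folklore] -/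
theorem fif_eq_zero_of_eval_eq_zero (M : ℕ) : ∀ Q : MvPowerSeries (Fin M) ℝ,
    wnorm (fun _ : Fin M => (1 : ℝ≥0)) Q < ⊤ → (∀ x ∈ KZ.cube M, eval Q x = 0) → Q = 0 := by
  induction M with
  | zero =>
    intro Q _ h
    ext α
    rw [Subsingleton.elim α 0, MvPowerSeries.coeff_zero_eq_constantCoeff_apply, map_zero,
      ← eval_zero_point]
    exact h 0 (KZ.mem_cube.2 fun i => i.elim0)
  | succ M ih =>
    intro Q hQ h
    obtain ⟨S, hS⟩ : ∃ S : ℕ → MvPowerSeries (Fin M) ℝ,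
        ∀ n β, coeff β (S n) = coeff (Finsupp.cons n β) Q :=
      ⟨fun n => show MvPowerSeries (Fin M) ℝ from fun β => coeff (Finsupp.cons n β) Q,
        fun _ _ => rfl⟩
    have hS0 : ∀ n, S n = 0 := by
      intro n
      refine ih (S n) ((fif_wnorm_slice_le Q S hS n).trans_lt hQ) fun x hx => ?_
      have hx1 := fif_nnnorm_le_of_mem_cube hx
      have hb : Summable fun n => ‖eval (S n) x‖ := by
        have h1 : ∑' n, (‖eval (S n) x‖₊ : ℝ≥0∞) ≤ wnorm (fun _ : Fin (M + 1) => (1 : ℝ≥0)) Q := by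
          rw [← fif_tsum_wnorm_slice Q S hS]
          exact ENNReal.tsum_le_tsum fun n => enorm_eval_le hx1 (S n)
        have h2 := ENNReal.tsum_coe_ne_top_iff_summable.1 (h1.trans_lt hQ).ne
        simpa only [coe_nnnorm] using NNReal.summable_coe.2 h2
      refine fif_coeff_eq_zero n (fun n => eval (S n) x) hb fun t ht => ?_
      show ∑' k, eval (S k) x * t ^ k = 0
      rw [(fif_hasSum_slice Q S hS hQ (fif_nnnorm_le_of_mem_Icc ht) hx1).tsum_eq]
      exact h _ (fif_cons_mem_cube ht hx)
    ext α
    rw [map_zero, ← Finsupp.cons_tail α, ← hS, hS0, map_zero]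

/-! ## The stub -/

/-- **Formal ⟺ functional algebraic relations** (all arguments explicit, proved in the helper
context). [Grauert–Remmert 1971, Kap. I §1–3; Krantz–Parks 2002, §2.2] -/
theorem fif_main : ∀ (M : ℕ) (F : MvPowerSeries (Fin M) ℝ) (ρ : ℝ), 1 < ρ → Summable (fun a : Fin M →₀ ℕ => |MvPowerSeries.coeff a F| * ρ ^ (a.sum fun _ e => e)) → ∀ (g : (Fin M → ℝ) → ℝ), (∀ x ∈ KZ.cube M, HasSum (fun a : Fin M →₀ ℕ => MvPowerSeries.coeff a F * a.prod (fun j e => x j ^ e)) (g x)) → ∀ (P : Polynomial (MvPolynomial (Fin M) ℚ)), Polynomial.eval₂ ((MvPolynomial.coeToMvPowerSeries.ringHom (σ := Fin M) (R := ℝ)).comp (MvPolynomial.map (algebraMap ℚ ℝ))) F P = 0 ↔ ∀ x ∈ KZ.cube M, Polynomial.eval₂ (MvPolynomial.aeval x : MvPolynomial (Fin M) ℚ →ₐ[ℚ] ℝ).toRingHom (g x) P = 0 := by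
  intro M F ρ hρ hF g hg P
  have hF1 : wnorm (fun _ : Fin M => (1 : ℝ≥0)) F < ⊤ := fif_wnorm_lt_top hρ.le hF
  have hgx : ∀ x ∈ KZ.cube M, g x = eval F x := fun x hx =>
    (hg x hx).unique (hasSum_eval (fif_nnnorm_le_of_mem_cube hx) hF1)
  set Q := Polynomial.eval₂ ((MvPolynomial.coeToMvPowerSeries.ringHom (σ := Fin M) (R := ℝ)).comp
    (MvPolynomial.map (algebraMap ℚ ℝ))) F P with hQdef
  have hQsum : Q = ∑ n ∈ P.support,
      ((MvPolynomial.map (algebraMap ℚ ℝ) (P.coeff n) : MvPolynomial (Fin M) ℝ) :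
        MvPowerSeries (Fin M) ℝ) * F ^ n := by
    simp only [hQdef, Polynomial.eval₂_eq_sum, Polynomial.sum_def, RingHom.coe_comp,
      Function.comp_apply, MvPolynomial.coeToMvPowerSeries.ringHom_apply]
  have hpow : ∀ n, wnorm (fun _ : Fin M => (1 : ℝ≥0)) (F ^ n) < ⊤ := fun n =>
    (wnorm_pow_le _ F n).trans_lt (ENNReal.pow_lt_top hF1)
  have hterm : ∀ n, wnorm (fun _ : Fin M => (1 : ℝ≥0))
      (((MvPolynomial.map (algebraMap ℚ ℝ) (P.coeff n) : MvPolynomial (Fin M) ℝ) :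
        MvPowerSeries (Fin M) ℝ) * F ^ n) < ⊤ := fun n =>
    (wnorm_mul_le _ _ _).trans_lt (ENNReal.mul_lt_top (fif_wnorm_coe_lt_top _ _) (hpow n))
  have hQ : wnorm (fun _ : Fin M => (1 : ℝ≥0)) Q < ⊤ := by
    rw [hQsum]
    exact (wnorm_sum_le _ _ _).trans_lt (ENNReal.sum_lt_top.2 fun n _ => hterm n)
  have hQx : ∀ x ∈ KZ.cube M, eval Q x =
      Polynomial.eval₂ (MvPolynomial.aeval x : MvPolynomial (Fin M) ℚ →ₐ[ℚ] ℝ).toRingHom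
        (g x) P := by
    intro x hx
    have hx1 := fif_nnnorm_le_of_mem_cube hx
    rw [Polynomial.eval₂_eq_sum, Polynomial.sum_def, hQsum,
      eval_finset_sum hx1 _ fun n _ => hterm n]
    refine Finset.sum_congr rfl fun n _ => ?_
    show _ = MvPolynomial.aeval x (P.coeff n) * g x ^ n
    rw [eval_mul hx1 (fif_wnorm_coe_lt_top _ _) (hpow n), eval_pow hx1 hF1 n, fif_eval_coe,
      MvPolynomial.eval_map, ← MvPolynomial.aeval_def, ← hgx x hx]
  constructor
  · intro h x hx
    rw [← hQx x hx, h, eval_zero]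
  · intro h
    exact fif_eq_zero_of_eval_eq_zero M Q hQ fun x hx => by rw [hQx x hx]; exact h x hx

end Helpers

open Set MeasureTheory
open Literature.NumberTheory.Transcendental
open Literature.NumberTheory.Transcendental.KZ hiding cubicalSpan
open Summit.KontsevichZagierPeriods.KontsevichZagierPeriods.Theses.FurushoPentagon

/-- **S3a (formal ⟺ functional algebraic relations for convergent real power series).** For a real
power series `F` in `M` variables with summable majorant of polyradius `ρ > 1`, summing to `g` on
the closed unit cube, and `P ∈ ℚ[x][Y]`: `P(F) = 0` formally in `ℝ⟦x⟧` iff `P(x, g x) = 0` for all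
`x ∈ [0,1]ᴹ` (⇒: evaluation of convergent series is a ring homomorphism,
`Literature/RingTheory/MvPowerSeries/ConvergentPowerSeries.lean`; ⇐: identity theorem — a
convergent power series vanishing on `[0,1]ᴹ` is `0`, `fif_eq_zero_of_eval_eq_zero`).
[Grauert–Remmert 1971, Kap. I §1–3; Krantz–Parks 2002, §2.2] -/
theorem stub_formalIffFunctional :
    ∀ (M : ℕ) (F : MvPowerSeries (Fin M) ℝ) (ρ : ℝ), 1 < ρ → Summable (fun a : Fin M →₀ ℕ => |MvPowerSeries.coeff a F| * ρ ^ (a.sum fun _ e => e)) → ∀ (g : (Fin M → ℝ) → ℝ), (∀ x ∈ KZ.cube M, HasSum (fun a : Fin M →₀ ℕ => MvPowerSeries.coeff a F * a.prod (fun j e => x j ^ e)) (g x)) → ∀ (P : Polynomial (MvPolynomial (Fin M) ℚ)), Polynomial.eval₂ ((MvPolynomial.coeToMvPowerSeries.ringHom (σ := Fin M) (R := ℝ)).comp (MvPolynomial.map (algebraMap ℚ ℝ))) F P = 0 ↔ ∀ x ∈ KZ.cube M, Polynomial.eval₂ (MvPolynomial.aeval x : MvPolynomial (Fin M) ℚ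 →ₐ[ℚ] ℝ).toRingHom (g x) P = 0 :=
  fif_main

end Summit.KontsevichZagierPeriods.FurushoPentagon.SectorToKernel
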